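import Summits.SmoothPoincare4.SmoothPoincare4.Theses.DottedCircleRasmussen
import Summits.SmoothPoincare4.SmoothPoincare4.Theorems.DottedCircleRasmussenDcrGfgmw

/-!
# `DcrGap` — negative-side support III: a witness circle is dotted-slice in NO 4-manifold that embeds in `S⁴`

Support lemmas for the crux `Summit.SmoothPoincare4.SmoothPoincare4.Theses.DottedCircleRasmussen.DcrGap`
(stmt-SmoothPoincare4-16128, route `DottedCircleRasmussen`), from the standing disprover's work file
`Cruxes/DcrGap/Disproof.lean` §3; companion of `NoDiscNormalForm.lean` (theorems only; nothing
here concludes the crux or any route item positively).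

The no-disc clause of the crux quantifies over CLOSED carriers `N ≅ S⁴`, but slice data travel
along arbitrary smooth embeddings of 4-manifolds (the tree's
`DcrGfgmw.isSliceDiscInComplement_comp`).  Hence:

* `not_noDisc_of_isSmoothEmbedding` — if the circle `K ⊂ ∂D_k` is dotted-slice in ANY smooth
  4-manifold `X` (open or not: `ℝ⁴`, an open subset of `S⁴`, a punctured homotopy sphere `Σ°`, a
  regular neighbourhood of `e(D_k) ∪ disc`, …) that smoothly EMBEDS in some `N ≅ S⁴`, then `K`
  violates the no-disc clause — it is never the witness circle of the crux;
* `not_isSmoothEmbedding_of_witness` — contrapositively, for a witness circle every carrier of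
  every one of its slice data fails to embed smoothly in `S⁴`; in particular (closed carriers,
  `NoDiscNormalForm.isEmpty_diffeomorph_of_witness`) the witnessing homotopy sphere is exotic, and,
  more usefully for candidate supply, a candidate `(Σ, e, f)` is DEAD as soon as some open
  neighbourhood of `e(ℝ⁴) ∪ f(ℝ²)` in `Σ` (e.g. the punctured sphere `Σ ∖ pt` when it avoids them)
  is shown to embed in `S⁴` — whatever any invariant says.

References: R. Palais, Proc. AMS 11 (1960) [Palais1960]; M. Freedman, R. Gompf, S. Morrison,
K. Walker, Quantum Topol. 1 (2010), §1 [FreedmanGompfMorrisonWalker2010].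
-/

noncomputable section

-- The namespace is prescribed by the crux protocol (`Summit.<P>.<Sub>.Theorems.<Crux>.Negative`
-- with `P = Sub = SmoothPoincare4`), hence the duplicated component.
set_option linter.dupNamespace false

open scoped Manifold ContDiff Topology
open Function Set
open Literature.Topology.FourManifolds Literature.Topology.FourManifolds.MMSW
open Summit.SmoothPoincare4.SmoothPoincare4.Theses.DottedCircleRasmussen

namespace Summit.SmoothPoincare4.SmoothPoincare4.Theorems.DcrGap.Negative

/-- **Dotted-slice in an `S⁴`-embeddable 4-manifold ⇒ not a witness.** If `K` bounds a slice datum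
`(e, f)` in the complement of `e(D_k)` inside a smooth 4-manifold `X`
(`MMSW.IsSliceDiscInComplement k K X e f`) and `J : X → N` is a smooth embedding into some smooth
`N ≅ S⁴`, then `(J ∘ e, J ∘ f)` is a datum in `N` (`DcrGfgmw.isSliceDiscInComplement_comp`), so the
no-disc clause of the crux fails for `K`. [folklore] -/
theorem not_noDisc_of_isSmoothEmbedding {X : Type*} [TopologicalSpace X]
    [ChartedSpace (EuclideanSpace ℝ (Fin 4)) X] [IsManifold (𝓡 4) ∞ X] {k : ℕ}
    {K : (Metric.sphere (0 : EuclideanSpace ℝ (Fin 2)) 1) → EuclideanSpace ℝ (Fin 4)}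
    {e : EuclideanSpace ℝ (Fin 4) → X} {f : EuclideanSpace ℝ (Fin 2) → X}
    (h : IsSliceDiscInComplement k K X e f)
    {N : Type} [TopologicalSpace N] [T2Space N] [SecondCountableTopology N]
    [ChartedSpace (EuclideanSpace ℝ (Fin 4)) N] [IsManifold (𝓡 4) ∞ N]
    (hN : Nonempty (N ≃ₘ⟮𝓡 4, 𝓡 4⟯ (Metric.sphere (0 : EuclideanSpace ℝ (Fin 5)) 1)))
    {J : X → N} (hJ : Manifold.IsSmoothEmbedding (𝓡 4) (𝓡 4) ∞ J) :
    ¬ ∀ (N : Type) [TopologicalSpace N] [T2Space N] [SecondCountableTopology N]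
        [ChartedSpace (EuclideanSpace ℝ (Fin 4)) N] [IsManifold (𝓡 4) ∞ N],
        Nonempty (N ≃ₘ⟮𝓡 4, 𝓡 4⟯ (Metric.sphere (0 : EuclideanSpace ℝ (Fin 5)) 1)) →
          ∀ (e' : EuclideanSpace ℝ (Fin 4) → N) (f' : EuclideanSpace ℝ (Fin 2) → N),
            ¬ IsSliceDiscInComplement k K N e' f' := fun hno =>
  hno N hN (J ∘ e) (J ∘ f) (Theorems.DcrGfgmw.isSliceDiscInComplement_comp h hJ)

/-- **For a witness circle, no carrier of a slice datum embeds in `S⁴`.** If `K` satisfies the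
no-disc clause and `(e, f)` is a slice datum for `K` in a smooth 4-manifold `X` (e.g. the witnessing
homotopy sphere, or ANY open subset of it containing `e(ℝ⁴) ∪ f(ℝ²)`, with the restricted datum),
then no map `X → S⁴` is a smooth embedding. Candidate supply dies here whenever such a
neighbourhood (a punctured sphere, a regular neighbourhood of handlebody-plus-disc) is shown to embed
in `S⁴`. [cite: FreedmanGompfMorrisonWalker2010, §1] -/
theorem not_isSmoothEmbedding_of_witness {k : ℕ}
    {K : (Metric.sphere (0 : EuclideanSpace ℝ (Fin 2)) 1) → EuclideanSpace ℝ (Fin 4)}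
    (hno : ∀ (N : Type) [TopologicalSpace N] [T2Space N] [SecondCountableTopology N]
      [ChartedSpace (EuclideanSpace ℝ (Fin 4)) N] [IsManifold (𝓡 4) ∞ N],
      Nonempty (N ≃ₘ⟮𝓡 4, 𝓡 4⟯ (Metric.sphere (0 : EuclideanSpace ℝ (Fin 5)) 1)) →
        ∀ (e' : EuclideanSpace ℝ (Fin 4) → N) (f' : EuclideanSpace ℝ (Fin 2) → N),
          ¬ IsSliceDiscInComplement k K N e' f')
    {X : Type*} [TopologicalSpace X] [ChartedSpace (EuclideanSpace ℝ (Fin 4)) X]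
    [IsManifold (𝓡 4) ∞ X] {e : EuclideanSpace ℝ (Fin 4) → X} {f : EuclideanSpace ℝ (Fin 2) → X}
    (h : IsSliceDiscInComplement k K X e f)
    (J : X → Metric.sphere (0 : EuclideanSpace ℝ (Fin 5)) 1) :
    ¬ Manifold.IsSmoothEmbedding (𝓡 4) (𝓡 4) ∞ J := fun hJ =>
  not_noDisc_of_isSmoothEmbedding h ⟨Diffeomorph.refl _ _ _⟩ hJ hno

end Summit.SmoothPoincare4.SmoothPoincare4.Theorems.DcrGap.Negative

end
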